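import Summits.Ventures.CertifiedManyBodySolver.Downfold.TPrimePinnedPairRowKernelForest
import Summits.Ventures.CertifiedManyBodySolver.Certificates.HubRm2uTierP.Head
import Summits.Ventures.CertifiedManyBodySolver.Theorems.CovLa214M2bItemsOfPairRows
import HarnessLib

/-!
# Ventures/CertifiedManyBodySolver — Theorems/CovLa214M2bItemsOfHubRm2uAndSpoke.lean: THE HUB CERTIFICATE OF RECORD AS A PAIR VERTEX —
# K1 / K2 / the rung leaf of route «CovLa214M2b» from the tier-P hub instance `Certificates/HubRm2uTierP/*` (head constants BY NAME) plus ONE pinned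
# spoke forest certificate each (cell `pub/hubbard-obs` × `pub/hubbard-downfold`, D-0154 (1)(C) COVERAGE La214; seat `hubbard-cov-la214-unc-2`,
# lineage desk; zero compute)

HONEST FRAMING (wording class (xx1): CONTROL / CALIBRATION one-sided flux-stiffness-scale CEILINGS on the downfolded La₂CuO₄ parent box «La214-E»,
D-0150 M2(b), route «CovLa214M2b»; K1 = stmt-Ventures-26183 `SegmentFanCeiling`, K2 = stmt-Ventures-26184 `TransportFanCeiling`). The kernel
t′-PAIR law (`Downfold/TPrimePinnedPairRow.lean`, `SquareTTPrimePinnedPairRowT`) prices a t′-SEGMENT of the Mott station `(U, n) = (29/5, 1)` from TWO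
certificate vertices solved with SHARED equation-of-motion multipliers (a PINNED pair). In the chain-forest kernel form of this base
(`Downfold/TPrimePinnedPairRowKernelForest.lean` §4, `SquareTTPrimePinnedPairRowT.of_forestTreeTBRowsHalfAuto_box`) each vertex is exactly ONE instance of
the single-vertex input shape of hubbard-cov-la214-box-2's `CARPolyWindow.affineOrbitLowerRowN_of_forestTreeTBRowsHalfAuto_box` — head constants
`D TH TE o TX μ ν κhi hi κlo lo K blocks EB CW AV ns`, forest facts `Hs segs forest_ok Cfin fin_ok`, ONE price — and the two vertices share `EB`.
THIS FILE plugs the HUB INSTANCE OF RECORD, `Certificates/HubRm2uTierP/Head.lean` (hubbard-algo-p2's exporter, hub-Rm2-u′ at `t′ = −3/10`, window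
`(r, R, vmax) = (6, 13, 7)`, `N = 729`, `Bkey = 2048`, f-sum objective `fsumTermsIdx (−3/10)`, 44 eom words `TierP.HubRm2u.EB`), into the pair law AS A
VERTEX, by name: §1 the K1 pair shape {hub −3/10, inner spoke −1/5} (own f-sum objectives; hub = vertex A), §2 the K2 pair shape {outer spoke −357/740,
hub −3/10} (corner objective `−X₀(−3/10)`; hub = vertex B), §3 K1 / K2 / the rung leaf `La214M2b_StiffnessBoxCeiling` BY NAME through
`Theorems/CovLa214M2bItemsOfPairRows.lean` (p673223) with the hub's multiplier signs discharged (`TierP.HubRm2u.κhi, κlo ≥ 0` by `norm_num`). The hub's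
own forest / merge / price facts (`Hs segs forest_ok Cfin fin_ok` of `Certificates/HubRm2uTierP/ForestTreeAssembly.lean`, `hub_lowerConst` of
hubbard-obs-p2's `Theorems/HubRm2uTierPCloserForestTree.lean`) are HYPOTHESES here (`HsH segsH hforestH CfinH hfinH hqH`), stated on the head constants by
name, so that the instance passes them verbatim once landed; the spoke (a pinned S1-class certificate at `t′ = −1/5`, resp. a pinned S2-class certificate
at `t′ = −357/740`, same window, `Bkey = 2048`, eom list IDENTICAL to the hub's: `hEB : EB_spoke = TierP.HubRm2u.EB`) is supplied in the head-constants
convention. THE PIN: `hEB` is the kernel form of the pair law's SHARED-EOM CLAUSE (`Downfold/TPrimePinnedPairRow.lean` §A: the two vertices' equation-of-motion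
multipliers coincide — a PINNED spoke is the hub-folded program `P̃_h(θ_s)` whose eom rows are removed and priced at the hub's exact multipliers `λʰ`, so its
kernel residual carries `Σ_r λʰ_r·[H_{θ_s}, B_r]`, i.e. the hub's list `EB` against its own `TH`); until now that clause was checked by readers (pinfold / fold-B
verdicts), here the kernel checks it (`rfl` when the spoke head imports the hub's `EB`, `decide` when it re-prints the same 44 products). A FREE spoke (its own eom
multipliers) is NOT a pair vertex under this law — no typed law prices the segment of an unpinned pair (its eq cross term is not zero). CONSEQUENCE (plumbing, by theorem): with the hub certificate of record in the tree, EACH of K1 / K2 is ONE pinned spoke certificate (+ its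
two / three rational side conditions against the hub's literals) away from a node-free kernel instance along this path. WHAT THIS IS NOT: nothing is
evaluated or asserted here — no `def`, no named fact, no `sorry`, no number of record; no spoke certificate exists in kernel form (nothing has printed);
whether a given spoke export carries the hub's eom list byte-for-byte is the exporter's contract, checked by `rfl`/`decide` in the instance, not here;
K1 / K2 stay OPEN · pen-HELD («closed modulo nodes» ≠ proved); a ceiling never speaks to `ρ_s = 0`, presence, `T_c`, pairing or phase; nothing about
La₂CuO₄ samples; no summit statement is proved by this file.

References: X. Han, arXiv:2006.06002 §3 [Han2020Bootstrap]; J. Wang et al., PRX 14 (2024) 031006 §III [WangEtAl2024]; C. Jansson, D. Chaykin,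
C. Keil, SIAM J. Numer. Anal. 46 (2008) 180 §3 [JanssonChaykinKeil2008]; T. Koma, H. Tasaki, J. Stat. Phys. 76 (1994) 745 §1 [KomaTasaki1994];
S. Boyd, L. Vandenberghe, *Convex Optimization* (2004) §5.9 [BoydVandenberghe2004].
-/

noncomputable section

namespace Summit.Ventures.CertifiedManyBodySolver.Theorems

open Literature.MathematicalPhysics.QuantumLattice
open Matrix HubbardWave0 Literature.Probability.LatticeModels ThermodynamicLimit Filter Topology
open Literature.MathematicalPhysics.QuantumManyBody.StateRelaxation
open Summit.Ventures.CertifiedQuantumChemistry Summit.Ventures.CertifiedQuantumChemistry.CARPoly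
open Summit.Ventures.CertifiedManyBodySolver.CARPolyWindow Summit.Ventures.CertifiedManyBodySolver.CARPolyWindow.BoxGeom
open Summit.Ventures.CertifiedManyBodySolver.Observables Summit.Ventures.CertifiedManyBodySolver.Downfold
open Summit.Ventures.CertifiedManyBodySolver.Theses.CovLa214M2b
open scoped BigOperators ComplexOrder

/-! ## §1 The K1 pair shape {HUB OF RECORD at `−3/10`, inner spoke at `−1/5`}, own f-sum objectives -/

section HubInner

/-- **K1 PAIR SHAPE FROM THE HUB CERTIFICATE OF RECORD + ONE PINNED INNER SPOKE.** Vertex A = the tier-P hub instance `Certificates/HubRm2uTierP/Head.lean`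
BY NAME (`TierP.HubRm2u.D TH TE o TX μ ν κhi hi κlo lo blocks EB CW ns slices`; `K = 40`, `AV = []`) with its forest / merge-certificate / price facts as
hypotheses `HsH segsH hforestH CfinH hfinH hqH` (the names `Hs segs forest_ok Cfin fin_ok hub_lowerConst` of the hub's assembly + closer, once landed);
vertex B = an S1-class spoke at `t′ = −1/5`, station `(29/5, 1)`, window `(6, 13, 7)`, `Bkey = 2048`, head-constants convention of
`SquareTTPrimePinnedPairRowT.of_forestTreeTBRowsHalfAuto_box`, PINNED to the hub: `hEB : EBS = TierP.HubRm2u.EB`. Conclusion: the K1 pair shape with own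
f-sum objectives `s ↦ −X₀(s, 29/5)`, hub literals `hi lo κhi κlo` by name, hub price `qH`. [cite: WangEtAl2024, §III] [cite: Han2020Bootstrap, §3]
[cite: JanssonChaykinKeil2008, §3] -/
theorem hubRm2u_innerSpoke_pinnedPairRowT
    -- the hub certificate of record (vertex A)
    (HsH : List (List (QHint 169))) (segsH : List Seg)
    (hforestH : ForestFrom TierP.HubRm2u.D 2048 TierP.HubRm2u.slices HsH 0 segsH)
    (CfinH : SOSDual.EncPoly) (hfinH : MergesTo 2048 (ends segsH) CfinH)
    {qH : ℚ} (hqH : qH ≤ lowerConst (SOSDual.decPoly 729 CfinH) + (TierP.HubRm2u.μ 0 + TierP.HubRm2u.μ 1) * (1 / 2 - TierP.HubRm2u.ν))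
    -- the pinned inner spoke (vertex B), head-constants convention
    (EBS : List (Terms (Orb (Fin 169)))) (hEB : EBS = TierP.HubRm2u.EB)
    (DS : QuotData 729 169) (hDS : DS = boxQuot 6 13 7)
    (THS : Terms (Orb (Fin 729))) (hTHS : THS = hamTermsBox 13 1 (-1 / 5) (29 / 5))
    (TES : Terms (Orb (Fin 729))) (hTES : TES = energyTermsIdx 1 (-1 / 5) (29 / 5) (boxIx 13))
    (oS : Fin 2 → Orb (Fin 729)) (hoS : oS = fun σ => orb (boxIx 13 0) σ)
    (TXS : Terms (Orb (Fin 729)))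
    (hXS : termOp (boxD 13) TXS = fermionEmbed (PolySite.incl (box_subset_boxW (show (7 : ℕ) ≤ 13 by norm_num)))
      (-oddMomentObsTT (((-1 / 5 : ℚ)) : ℝ) (29 / 5) 0))
    (μS : Fin 2 → ℚ) (νS κhiS hiS κloS loS : ℚ)
    (KS : ℕ) (blocksS : List (List (List ℤ × Terms (Orb (Fin 729)))))
    (CWS : Terms (Orb (Fin 729))) (hcwS : ∀ wc ∈ CWS, chargeW wc.1 ≠ 0 ∨ spinChargeW (fun a => (ofLex a).2) wc.1 ≠ 0)
    (AVS : List (Terms (Orb (Fin 729))))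
    (nsS : List ℕ) (HsS : List (List (QHint 169))) (segsS : List Seg)
    (hforestS : ForestFrom DS 2048
      (groupSlices (residTGslicesNear TXS μS νS oS κhiS hiS κloS loS TES (gramTBRowsHalf KS blocksS) THS DS.f EBS (autoMasks THS DS.f EBS)
        (fun l : Fin 0 => l.elim0) (fun l : Fin 0 => l.elim0) CWS AVS) nsS) HsS 0 segsS)
    (CfinS : SOSDual.EncPoly) (hfinS : MergesTo 2048 (ends segsS) CfinS)
    {βS : ℚ} (hβS : βS ≤ lowerConst (SOSDual.decPoly 729 CfinS) + (μS 0 + μS 1) * (1 / 2 - νS)) :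
    SquareTTPrimePinnedPairRowT (29 / 5) 1 (-3 / 10) (-1 / 5) TierP.HubRm2u.hi hiS TierP.HubRm2u.lo loS
      qH TierP.HubRm2u.κhi TierP.HubRm2u.κlo βS κhiS κloS (fun s => -oddMomentObsTT s (29 / 5) 0) := by
  have h13 : (7 : ℕ) ≤ 13 := by norm_num
  have hp := SquareTTPrimePinnedPairRowT.of_forestTreeTBRowsHalfAuto_box 6 13 7 h13 (by norm_num) (by norm_num)
    (29 / 5) (by norm_num) 1 (by norm_num) (by norm_num) (-3 / 10) (-1 / 5) 2048 (fun s => -oddMomentObsTT s (29 / 5) 0)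
    TierP.HubRm2u.EB EBS hEB
    TierP.HubRm2u.D rfl TierP.HubRm2u.TH rfl TierP.HubRm2u.TE rfl TierP.HubRm2u.o rfl
    TierP.HubRm2u.TX (termOp_boxD_fsumTermsIdx h13 _ _)
    TierP.HubRm2u.μ TierP.HubRm2u.ν TierP.HubRm2u.κhi TierP.HubRm2u.hi TierP.HubRm2u.κlo TierP.HubRm2u.lo 40 TierP.HubRm2u.blocks
    TierP.HubRm2u.CW (fun wc hwc => by rw [TierP.HubRm2u.CW] at hwc; cases hwc) []
    TierP.HubRm2u.ns HsH segsH hforestH CfinH hfinH hqH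
    DS hDS THS hTHS TES hTES oS hoS TXS hXS μS νS κhiS hiS κloS loS KS blocksS CWS hcwS AVS nsS HsS segsS hforestS CfinS hfinS hβS
  have e1 : ((29 / 5 : ℚ) : ℝ) = 29 / 5 := by norm_num
  have e2 : ((1 : ℚ) : ℝ) = 1 := by norm_num
  have e3 : ((-3 / 10 : ℚ) : ℝ) = -3 / 10 := by norm_num
  have e4 : ((-1 / 5 : ℚ) : ℝ) = -1 / 5 := by norm_num
  rw [e1, e2, e3, e4] at hp
  exact hp

end HubInner

/-! ## §2 The K2 pair shape {outer spoke at `−357/740`, HUB OF RECORD at `−3/10`}, corner objective `−X₀(−3/10, 29/5)` -/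

section OuterHub

/-- **K2 PAIR SHAPE FROM ONE PINNED OUTER SPOKE + THE HUB CERTIFICATE OF RECORD.** Vertex A = an S2-class spoke at `t′ = −357/740` read with the CORNER
objective `−X₀(−3/10, 29/5)` (its `TX` discharged by `termOp_boxD_fsumTermsIdx_cast`), head-constants convention, PINNED to the hub (`hEB`); vertex B =
the hub instance BY NAME (its own f-sum objective at `−3/10` IS the corner objective) with `HsH segsH hforestH CfinH hfinH hqH` as in §1.
[cite: WangEtAl2024, §III] [cite: Han2020Bootstrap, §3] [cite: JanssonChaykinKeil2008, §3] -/
theorem outerSpoke_hubRm2u_pinnedPairRowT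
    -- the pinned outer spoke (vertex A), head-constants convention
    (EBS : List (Terms (Orb (Fin 169)))) (hEB : EBS = TierP.HubRm2u.EB)
    (DS : QuotData 729 169) (hDS : DS = boxQuot 6 13 7)
    (THS : Terms (Orb (Fin 729))) (hTHS : THS = hamTermsBox 13 1 (-(357 / 740)) (29 / 5))
    (TES : Terms (Orb (Fin 729))) (hTES : TES = energyTermsIdx 1 (-(357 / 740)) (29 / 5) (boxIx 13))
    (oS : Fin 2 → Orb (Fin 729)) (hoS : oS = fun σ => orb (boxIx 13 0) σ)
    (TXS : Terms (Orb (Fin 729)))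
    (hXS : termOp (boxD 13) TXS = fermionEmbed (PolySite.incl (box_subset_boxW (show (7 : ℕ) ≤ 13 by norm_num)))
      (-oddMomentObsTT (-3 / 10) (29 / 5) 0))
    (μS : Fin 2 → ℚ) (νS κhiS hiS κloS loS : ℚ)
    (KS : ℕ) (blocksS : List (List (List ℤ × Terms (Orb (Fin 729)))))
    (CWS : Terms (Orb (Fin 729))) (hcwS : ∀ wc ∈ CWS, chargeW wc.1 ≠ 0 ∨ spinChargeW (fun a => (ofLex a).2) wc.1 ≠ 0)
    (AVS : List (Terms (Orb (Fin 729))))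
    (nsS : List ℕ) (HsS : List (List (QHint 169))) (segsS : List Seg)
    (hforestS : ForestFrom DS 2048
      (groupSlices (residTGslicesNear TXS μS νS oS κhiS hiS κloS loS TES (gramTBRowsHalf KS blocksS) THS DS.f EBS (autoMasks THS DS.f EBS)
        (fun l : Fin 0 => l.elim0) (fun l : Fin 0 => l.elim0) CWS AVS) nsS) HsS 0 segsS)
    (CfinS : SOSDual.EncPoly) (hfinS : MergesTo 2048 (ends segsS) CfinS)
    {βS : ℚ} (hβS : βS ≤ lowerConst (SOSDual.decPoly 729 CfinS) + (μS 0 + μS 1) * (1 / 2 - νS))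
    -- the hub certificate of record (vertex B)
    (HsH : List (List (QHint 169))) (segsH : List Seg)
    (hforestH : ForestFrom TierP.HubRm2u.D 2048 TierP.HubRm2u.slices HsH 0 segsH)
    (CfinH : SOSDual.EncPoly) (hfinH : MergesTo 2048 (ends segsH) CfinH)
    {qH : ℚ} (hqH : qH ≤ lowerConst (SOSDual.decPoly 729 CfinH) + (TierP.HubRm2u.μ 0 + TierP.HubRm2u.μ 1) * (1 / 2 - TierP.HubRm2u.ν)) :
    SquareTTPrimePinnedPairRowT (29 / 5) 1 (-(357 / 740)) (-3 / 10) hiS TierP.HubRm2u.hi loS TierP.HubRm2u.lo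
      βS κhiS κloS qH TierP.HubRm2u.κhi TierP.HubRm2u.κlo (fun _ => -oddMomentObsTT (-3 / 10) (29 / 5) 0) := by
  have h13 : (7 : ℕ) ≤ 13 := by norm_num
  have hub_tp : ((TierP.HubRm2u.tp : ℚ) : ℝ) = -3 / 10 := by rw [TierP.HubRm2u.tp]; push_cast; ring
  have hp := SquareTTPrimePinnedPairRowT.of_forestTreeTBRowsHalfAuto_box 6 13 7 h13 (by norm_num) (by norm_num)
    (29 / 5) (by norm_num) 1 (by norm_num) (by norm_num) (-(357 / 740)) (-3 / 10) 2048 (fun _ => -oddMomentObsTT (-3 / 10) (29 / 5) 0)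
    EBS TierP.HubRm2u.EB hEB.symm
    DS hDS THS hTHS TES hTES oS hoS TXS hXS μS νS κhiS hiS κloS loS KS blocksS CWS hcwS AVS nsS HsS segsS hforestS CfinS hfinS hβS
    TierP.HubRm2u.D rfl TierP.HubRm2u.TH rfl TierP.HubRm2u.TE rfl TierP.HubRm2u.o rfl
    TierP.HubRm2u.TX (termOp_boxD_fsumTermsIdx_cast h13 TierP.HubRm2u.tp (-3 / 10) (29 / 5) hub_tp)
    TierP.HubRm2u.μ TierP.HubRm2u.ν TierP.HubRm2u.κhi TierP.HubRm2u.hi TierP.HubRm2u.κlo TierP.HubRm2u.lo 40 TierP.HubRm2u.blocks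
    TierP.HubRm2u.CW (fun wc hwc => by rw [TierP.HubRm2u.CW] at hwc; cases hwc) []
    TierP.HubRm2u.ns HsH segsH hforestH CfinH hfinH hqH
  have e1 : ((29 / 5 : ℚ) : ℝ) = 29 / 5 := by norm_num
  have e2 : ((1 : ℚ) : ℝ) = 1 := by norm_num
  have e3 : ((-3 / 10 : ℚ) : ℝ) = -3 / 10 := by norm_num
  have e4 : ((-(357 / 740) : ℚ) : ℝ) = -(357 / 740) := by norm_num
  rw [e1, e2, e3, e4] at hp
  exact hp

end OuterHub

/-! ## §3 K1 / K2 / the rung leaf BY NAME from the hub of record + one pinned spoke each -/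

section Items

/-- **K1 «SegmentFanCeiling» (stmt-Ventures-26183) ⇐ THE HUB CERTIFICATE OF RECORD + ONE PINNED INNER SPOKE** (VERTEX kind of the kernel t′-pair law
via `covLa214M2b_SegmentFanCeiling_of_pairRow_hubS1`, p673223): the hub's multiplier signs `0 ≤ TierP.HubRm2u.κhi`, `0 ≤ TierP.HubRm2u.κlo` are
discharged here; the spoke's signs, the vertex-kind condition `hL`, the slot `hF` and the bar `hbar` are the instance's rational side conditions (hub
literals by name: `TierP.HubRm2u.hi = −7685114443312941590890261/12089258196146291747061760`, `lo`, `κhi = 1400235889/2³³`, `κlo = 113/2⁴⁰`, all `rfl`).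
This does NOT close K1: no spoke has printed; the item stays OPEN · pen-HELD. [cite: KomaTasaki1994, §1] [cite: BoydVandenberghe2004, §5.9] -/
theorem covLa214M2b_SegmentFanCeiling_of_hubRm2u_innerSpoke
    (HsH : List (List (QHint 169))) (segsH : List Seg)
    (hforestH : ForestFrom TierP.HubRm2u.D 2048 TierP.HubRm2u.slices HsH 0 segsH)
    (CfinH : SOSDual.EncPoly) (hfinH : MergesTo 2048 (ends segsH) CfinH)
    {qH : ℚ} (hqH : qH ≤ lowerConst (SOSDual.decPoly 729 CfinH) + (TierP.HubRm2u.μ 0 + TierP.HubRm2u.μ 1) * (1 / 2 - TierP.HubRm2u.ν))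
    (EBS : List (Terms (Orb (Fin 169)))) (hEB : EBS = TierP.HubRm2u.EB)
    (DS : QuotData 729 169) (hDS : DS = boxQuot 6 13 7)
    (THS : Terms (Orb (Fin 729))) (hTHS : THS = hamTermsBox 13 1 (-1 / 5) (29 / 5))
    (TES : Terms (Orb (Fin 729))) (hTES : TES = energyTermsIdx 1 (-1 / 5) (29 / 5) (boxIx 13))
    (oS : Fin 2 → Orb (Fin 729)) (hoS : oS = fun σ => orb (boxIx 13 0) σ)
    (TXS : Terms (Orb (Fin 729)))
    (hXS : termOp (boxD 13) TXS = fermionEmbed (PolySite.incl (box_subset_boxW (show (7 : ℕ) ≤ 13 by norm_num)))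
      (-oddMomentObsTT (((-1 / 5 : ℚ)) : ℝ) (29 / 5) 0))
    (μS : Fin 2 → ℚ) (νS κhiS hiS κloS loS : ℚ)
    (KS : ℕ) (blocksS : List (List (List ℤ × Terms (Orb (Fin 729)))))
    (CWS : Terms (Orb (Fin 729))) (hcwS : ∀ wc ∈ CWS, chargeW wc.1 ≠ 0 ∨ spinChargeW (fun a => (ofLex a).2) wc.1 ≠ 0)
    (AVS : List (Terms (Orb (Fin 729))))
    (nsS : List ℕ) (HsS : List (List (QHint 169))) (segsS : List Seg)
    (hforestS : ForestFrom DS 2048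
      (groupSlices (residTGslicesNear TXS μS νS oS κhiS hiS κloS loS TES (gramTBRowsHalf KS blocksS) THS DS.f EBS (autoMasks THS DS.f EBS)
        (fun l : Fin 0 => l.elim0) (fun l : Fin 0 => l.elim0) CWS AVS) nsS) HsS 0 segsS)
    (CfinS : SOSDual.EncPoly) (hfinS : MergesTo 2048 (ends segsS) CfinS)
    {βS : ℚ} (hβS : βS ≤ lowerConst (SOSDual.decPoly 729 CfinS) + (μS 0 + μS 1) * (1 / 2 - νS))
    -- the K1 closer's side conditions (the hub's signs discharged below)
    (hκS : 0 ≤ κhiS) (hκS' : 0 ≤ κloS) (F : ℚ)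
    (hL : (1 / 10 : ℝ) * |((((κhiS - TierP.HubRm2u.κhi) - (κloS - TierP.HubRm2u.κlo) : ℚ)) : ℝ)| * (((16211390 / 10000000 : ℚ)) : ℝ) -
        ((((κloS - TierP.HubRm2u.κlo) * (-((-16 / 5 : ℚ) - (-14 / 5))) : ℚ)) : ℝ) ≤
      |(((βS - κhiS * (-3039267953 / 5000000000 - hiS) - κloS * (loS - (-16 / 5)) : ℚ)) : ℝ) -
        (((qH - TierP.HubRm2u.κhi * (-3039267953 / 5000000000 - TierP.HubRm2u.hi) - TierP.HubRm2u.κlo * (TierP.HubRm2u.lo - (-14 / 5)) : ℚ)) : ℝ)|)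
    (hF : F ≤ min (qH - TierP.HubRm2u.κhi * (-3039267953 / 5000000000 - TierP.HubRm2u.hi) - TierP.HubRm2u.κlo * (TierP.HubRm2u.lo - (-14 / 5)))
      (βS - κhiS * (-3039267953 / 5000000000 - hiS) - κloS * (loS - (-16 / 5))))
    (hbar : -F ≤ 4364687 / 10000000) :
    SegmentFanCeiling :=
  covLa214M2b_SegmentFanCeiling_of_pairRow_hubS1 TierP.HubRm2u.hi hiS TierP.HubRm2u.lo loS qH TierP.HubRm2u.κhi TierP.HubRm2u.κlo βS κhiS κloS
    (hubRm2u_innerSpoke_pinnedPairRowT HsH segsH hforestH CfinH hfinH hqH EBS hEB DS hDS THS hTHS TES hTES oS hoS TXS hXS μS νS κhiS hiS κloS loS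
      KS blocksS CWS hcwS AVS nsS HsS segsS hforestS CfinS hfinS hβS)
    (by rw [TierP.HubRm2u.κhi]; norm_num) (by rw [TierP.HubRm2u.κlo]; norm_num) hκS hκS' F hL hF hbar

/-- **K2 «TransportFanCeiling» (stmt-Ventures-26184) ⇐ ONE PINNED OUTER SPOKE + THE HUB CERTIFICATE OF RECORD** (INTERIOR kind via
`covLa214M2b_TransportFanCeiling_of_pairRow_S2hub`, p673223; `L` with its defining equation `hLdef`, `0 < L`, slot `hF`, bar `hbar` = the instance's
side conditions; hub signs discharged). Does NOT close K2 (no spoke has printed; OPEN · pen-HELD). [cite: KomaTasaki1994, §1] [cite: BoydVandenberghe2004, §5.9] -/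
theorem covLa214M2b_TransportFanCeiling_of_outerSpoke_hubRm2u
    (EBS : List (Terms (Orb (Fin 169)))) (hEB : EBS = TierP.HubRm2u.EB)
    (DS : QuotData 729 169) (hDS : DS = boxQuot 6 13 7)
    (THS : Terms (Orb (Fin 729))) (hTHS : THS = hamTermsBox 13 1 (-(357 / 740)) (29 / 5))
    (TES : Terms (Orb (Fin 729))) (hTES : TES = energyTermsIdx 1 (-(357 / 740)) (29 / 5) (boxIx 13))
    (oS : Fin 2 → Orb (Fin 729)) (hoS : oS = fun σ => orb (boxIx 13 0) σ)
    (TXS : Terms (Orb (Fin 729)))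
    (hXS : termOp (boxD 13) TXS = fermionEmbed (PolySite.incl (box_subset_boxW (show (7 : ℕ) ≤ 13 by norm_num)))
      (-oddMomentObsTT (-3 / 10) (29 / 5) 0))
    (μS : Fin 2 → ℚ) (νS κhiS hiS κloS loS : ℚ)
    (KS : ℕ) (blocksS : List (List (List ℤ × Terms (Orb (Fin 729)))))
    (CWS : Terms (Orb (Fin 729))) (hcwS : ∀ wc ∈ CWS, chargeW wc.1 ≠ 0 ∨ spinChargeW (fun a => (ofLex a).2) wc.1 ≠ 0)
    (AVS : List (Terms (Orb (Fin 729))))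
    (nsS : List ℕ) (HsS : List (List (QHint 169))) (segsS : List Seg)
    (hforestS : ForestFrom DS 2048
      (groupSlices (residTGslicesNear TXS μS νS oS κhiS hiS κloS loS TES (gramTBRowsHalf KS blocksS) THS DS.f EBS (autoMasks THS DS.f EBS)
        (fun l : Fin 0 => l.elim0) (fun l : Fin 0 => l.elim0) CWS AVS) nsS) HsS 0 segsS)
    (CfinS : SOSDual.EncPoly) (hfinS : MergesTo 2048 (ends segsS) CfinS)
    {βS : ℚ} (hβS : βS ≤ lowerConst (SOSDual.decPoly 729 CfinS) + (μS 0 + μS 1) * (1 / 2 - νS))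
    (HsH : List (List (QHint 169))) (segsH : List Seg)
    (hforestH : ForestFrom TierP.HubRm2u.D 2048 TierP.HubRm2u.slices HsH 0 segsH)
    (CfinH : SOSDual.EncPoly) (hfinH : MergesTo 2048 (ends segsH) CfinH)
    {qH : ℚ} (hqH : qH ≤ lowerConst (SOSDual.decPoly 729 CfinH) + (TierP.HubRm2u.μ 0 + TierP.HubRm2u.μ 1) * (1 / 2 - TierP.HubRm2u.ν))
    -- the K2 closer's side conditions (the hub's signs discharged below)
    (hκS : 0 ≤ κhiS) (hκS' : 0 ≤ κloS) (F L : ℚ)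
    (hLdef : ((L : ℚ) : ℝ) = ((-3 / 10 : ℝ) - (-(357 / 740))) *
        |((((TierP.HubRm2u.κhi - κhiS) - (TierP.HubRm2u.κlo - κloS) : ℚ)) : ℝ)| * (((16211390 / 10000000 : ℚ)) : ℝ) -
        ((((TierP.HubRm2u.κlo - κloS) * (-((-14 / 5 : ℚ) - (-383 / 185))) : ℚ)) : ℝ))
    (hLpos : 0 < L)
    (hF : ((F : ℚ) : ℝ) ≤ (((βS - κhiS * (-3039267953 / 5000000000 - hiS) - κloS * (loS - (-383 / 185)) : ℚ)) : ℝ) -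
        (((L : ℚ) : ℝ) - ((((qH - TierP.HubRm2u.κhi * (-3039267953 / 5000000000 - TierP.HubRm2u.hi) -
            TierP.HubRm2u.κlo * (TierP.HubRm2u.lo - (-14 / 5)) : ℚ)) : ℝ) -
          (((βS - κhiS * (-3039267953 / 5000000000 - hiS) - κloS * (loS - (-383 / 185)) : ℚ)) : ℝ))) ^ 2 / (4 * ((L : ℚ) : ℝ)))
    (hbar : -F ≤ 4364687 / 10000000) :
    TransportFanCeiling :=
  covLa214M2b_TransportFanCeiling_of_pairRow_S2hub hiS TierP.HubRm2u.hi loS TierP.HubRm2u.lo βS κhiS κloS qH TierP.HubRm2u.κhi TierP.HubRm2u.κlo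
    (outerSpoke_hubRm2u_pinnedPairRowT EBS hEB DS hDS THS hTHS TES hTES oS hoS TXS hXS μS νS κhiS hiS κloS loS KS blocksS CWS hcwS AVS nsS HsS
      segsS hforestS CfinS hfinS hβS HsH segsH hforestH CfinH hfinH hqH)
    hκS hκS' (by rw [TierP.HubRm2u.κhi]; norm_num) (by rw [TierP.HubRm2u.κlo]; norm_num) F L hLdef hLpos hF hbar

end Items

end Summit.Ventures.CertifiedManyBodySolver.Theorems

end
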